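import Literature.NumberTheory.GaloisRepresentations.CyclicExtensionOfInvariantRep
import Literature.NumberTheory.GaloisRepresentations.AbsGaloisOuterConj
import Mathlib.NumberTheory.Padics.Complex
import Mathlib.GroupTheory.SpecificGroups.Cyclic.Basic
import Mathlib.FieldTheory.Galois.Basic
import HarnessLib

/-!
# Extend-or-regular dichotomy along a Galois layer of PRIME degree
# (crux `AscentConjugationSolvable`, stmt-Langlands-1094; piece `CyclicPrimeAscent`; lead c3 helper stub H1)

Support file (closes nothing).  Let `L/K` be a Galois extension of number fields of PRIME degree
`p = [L:K]`, `ℓ` a prime and `ρ : Γ_L → GL_n(ℚ̄_ℓ)` an IRREDUCIBLE framed Galois representation.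
Then either

* `ρ` EXTENDS to `Γ_K`: `ρ = ρ₀|_{Γ_L}` (`FramedGaloisRep.restrictField`, along
  `absGaloisRestrict K L`) for a framed Galois representation `ρ₀` of `Γ_K`, or
* `ρ` is **Galois-regular**: no conjugate `ρ^g` (`FramedGaloisRep.outerConj`) by an element
  `g ∈ Γ_K` outside `res(Γ_L)` is isomorphic to `ρ` (a change of frame `P · ρ^g · P⁻¹ = ρ`).

This is Clifford's dichotomy for a normal subgroup of prime index (Clifford 1937, Thm. 1 and
§§3–4; Isaacs, *Character theory of finite groups*, (11.22)): if some `ρ^g ≅ ρ` with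
`g ∉ res(Γ_L)`, then the image `ḡ ≠ 1` of `g` in the quotient `Γ_K / res(Γ_L) ≅ Gal(L/K)`
(`absGaloisQuot`, kernel `absGaloisQuot_eq_one_iff`), a group of prime order
(`IsGalois.card_aut_eq_finrank`), generates it (`mem_zpowers_of_prime_card`); hence
`Γ_K = ⋃_k res(Γ_L) · g ^ k` with `g ^ k ∈ res(Γ_L) ↔ ord(ḡ) ∣ k`, and the abstract extension
theorem across a subgroup of cyclic index
(`FramedRep.exists_comp_eq_of_forall_mem_range_iff`, the tree's form of Isaacs (11.22): the
intertwiner `B` of `ρ ∘ θ_g ≅ ρ` is normalised by Schur's lemma over the algebraically closed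
field `ℚ̄_ℓ` and `ρ₀ (res σ · g ^ k) := ρ σ · B ^ k`) produces the extension `ρ₀`.

References: A. H. Clifford, *Representations induced in an invariant subgroup*, Ann. of Math. 38
(1937), Thm. 1, §§3–4; I. M. Isaacs, *Character theory of finite groups* (1976), (6.19), (11.22).
-/

noncomputable section

set_option linter.dupNamespace false -- project-wide option; `Summit.Langlands.Langlands` is the mandated namespace

namespace Summit.Langlands.Langlands.Theorems.SmithKummerSeedCyclicPrimeAscent

open scoped MatrixGroups NumberField Classical Matrix Polynomial
open Filter IsDedekindDomain Field
open Literature.NumberTheory.GaloisRepresentations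

/-- **Extend-or-regular dichotomy along a Galois layer of PRIME degree** (Clifford 1937 /
Isaacs (11.22)): for `L/K` Galois of prime degree and `ρ : Γ_L → GL_n(ℚ̄_ℓ)` irreducible, either
`ρ` is the restriction of a framed representation of `Γ_K`, or none of its conjugates `ρ^g`,
`g ∉ res(Γ_L)`, is isomorphic to `ρ`.  Proof: if `P · ρ^g · P⁻¹ = ρ` for some `g ∉ res(Γ_L)`, the
image of `g` generates the quotient `Γ_K / res(Γ_L) ≅ Gal(L/K)` of prime order, and the abstract
extension theorem `FramedRep.exists_comp_eq_of_forall_mem_range_iff` (intertwiner normalised by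
Schur's lemma over `ℚ̄_ℓ`) extends `ρ` across `⟨res(Γ_L), g⟩ = Γ_K`.
[cite: Isaacs1976, (11.22)] [cite: Clifford1937, Thm. 1] -/
theorem extendsOrRegular_of_prime : ∀ (K L : Type) [Field K] [NumberField K] [Field L] [NumberField L] [Algebra K L] [IsGalois K L], (Module.finrank K L).Prime → ∀ (ℓ : ℕ) [Fact ℓ.Prime] (n : ℕ) (ρ : Literature.NumberTheory.GaloisRepresentations.FramedGaloisRep L (PadicAlgCl ℓ) n), ρ.toGaloisRep.IsIrreducible → (∃ ρ₀ : Literature.NumberTheory.GaloisRepresentations.FramedGaloisRep K (PadicAlgCl ℓ) n, ρ₀.restrictField L = ρ) ∨ (∀ g : Field.absoluteGaloisGroup K, g ∉ Set.range (Literature.NumberTheory.GaloisRepresentations.absGaloisRestrict K L) → ∀ P : GL (Fin n) (PadicAlgCl ℓ), Literature.NumberTheory.GaloisRepresentations.FramedRep.conj P (ρ.outerConj g) ≠ ρ) := by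
  intro K L _ _ _ _ _ _ hp ℓ _ n ρ hirr
  by_cases h : ∃ g : absoluteGaloisGroup K, g ∉ Set.range (absGaloisRestrict K L) ∧
      ∃ P : GL (Fin n) (PadicAlgCl ℓ), FramedRep.conj P (ρ.outerConj g) = ρ
  swap
  · push Not at h
    exact Or.inr h
  obtain ⟨g, hg, P, hP⟩ := h
  refine Or.inl ?_
  haveI : FiniteDimensional K L := Module.finite_of_finrank_pos hp.pos
  haveI : Fact (Module.finrank K L).Prime := ⟨hp⟩
  -- the quotient map `q : Γ_K → Gal(L/K)` has kernel `res(Γ_L)`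
  have hq : ∀ τ : absoluteGaloisGroup K,
      absGaloisQuot K L τ = 1 ↔ τ ∈ Set.range (absGaloisRestrict K L) := fun τ => by
    rw [absGaloisQuot_eq_one_iff]
    rfl
  -- `ḡ ≠ 1` generates the quotient, a group of prime order `[L:K]`
  have hg1 : absGaloisQuot K L g ≠ 1 := fun h1 => hg ((hq g).1 h1)
  have hgen : ∀ x : L ≃ₐ[K] L, x ∈ Subgroup.zpowers (absGaloisQuot K L g) := fun _ =>
    mem_zpowers_of_prime_card (IsGalois.card_aut_eq_finrank K L) hg1
  -- the abstract extension theorem across `⟨res(Γ_L), g⟩ = Γ_K`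
  refine FramedRep.exists_comp_eq_of_forall_mem_range_iff (absGaloisRestrict K L)
    (isOpenEmbedding_absGaloisRestrict K L) g (orderOf (absGaloisQuot K L g))
    (absGaloisOuterConj K L g) (absGaloisRestrict_absGaloisOuterConj K L g)
    (fun τ => ?_) (fun j => ?_) ρ hirr P⁻¹ (fun σ => ?_)
  · -- every `τ ∈ Γ_K` is `res σ · g ^ j`
    obtain ⟨j, hj⟩ := Subgroup.mem_zpowers_iff.1 (hgen (absGaloisQuot K L τ))
    obtain ⟨σ, hσ⟩ : τ * g ^ (-j) ∈ Set.range (absGaloisRestrict K L) := (hq _).1 (by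
      rw [map_mul, map_zpow, ← hj, ← zpow_add, add_neg_cancel, zpow_zero])
    exact ⟨j, σ, by rw [hσ, zpow_neg, inv_mul_cancel_right]⟩
  · -- `g ^ j ∈ res(Γ_L) ↔ ord(ḡ) ∣ j`
    rw [← hq, map_zpow, orderOf_dvd_iff_zpow_eq_one]
  · -- `ρ (θ_g σ) = P⁻¹ · ρ σ · P`
    have h2 := congrArg (fun r : FramedGaloisRep L (PadicAlgCl ℓ) n => r σ) hP
    simp only [FramedRep.conj_apply, FramedGaloisRep.outerConj_apply] at h2
    rw [← h2]
    group

end Summit.Langlands.Langlands.Theorems.SmithKummerSeedCyclicPrimeAscent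

end
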